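import Literature.NumberTheory.Transcendental.PkappaThetaLaws
import HarnessLib

/-!
# Multiplication by `n` on the theta model of `M_κ`: complete families of forms

Topic: `Literature/NumberTheory/Transcendental`. A brick of the programme towards the named fact
`Literature.NumberTheory.Transcendental.philippon1986_std` with TWO OR MORE elliptic factors: the
classification of the obstruction subgroups of Philippon's zero estimate on
`M_κ = 𝔾ₘ^β × P_κ` needs, for every integer relation `∑ c_b z'_b ≡ 0` among the elliptic
coordinates, homogeneous FORMS in the theta functions `Θ_J` (`PkappaTheta.lean`) cutting out the
corresponding algebraic subgroup — hence forms computing the multiplication maps `[n]` of the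
group `M_κ` in the theta embedding. Instead of division polynomials we ITERATE the complete system
of addition laws of `PkappaThetaLaws.lean` (`GaGmE.Std.claw`, `eval_claw`,
`exists_clawUnit_clawFamily_ne_zero`): with `Θ((n+1)w) ∝ A^{(s)}(Θ(n w), Θ(w))`,

* `GaGmE.Std.mulForm l I` — for a chain `l = [s₁, …, sₙ]` of auxiliary parameters, a form of
  degree `mulDeg n` (`mulDeg 0 = 1`, `mulDeg (n+1) = 4 mulDeg n + 4`; `mulForm_isHomogeneous`)
  with **`F_{mulForm l I}(w) = mulUnit l w · Θ_I((n+1) w)`** for ALL `w` (`thetaEval_mulForm`),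
  the unit `mulUnit l` being an explicit entire function (`analyticOnNhd_mulUnit`);
* **completeness** (`exists_mulUnit_ne_zero`): for every `n` and every `w` some chain of length
  `n` drawn from the finite family `clawFamily` has `mulUnit l w ≠ 0` — so the finitely many forms
  `mulForm l`, `l ∈ clawFamily^n`, compute `[n+1]` everywhere on `V`, projectively.

Also `isHomogeneous_bind₁_sumElim`: binding a bihomogeneous `P(X, Y)` of bidegree `(a, b)` with
forms of degree `d` in `X` and the variables in `Y` gives a form of degree `d a + b`.
Everything is PROVED; no named facts.

## References

* Yu. V. Nesterenko, P. Philippon (eds.), *Introduction to Algebraic Independence Theory*,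
  LNM 1752, Springer 2001, Ch. 11 (D. Roy), §2.1 (complete systems of addition laws).
  [NesterenkoPhilippon2001]
* D. Bertrand, P. Philippon, *Sous-groupes algébriques de groupes algébriques commutatifs*,
  Illinois J. Math. 32 (1988), 263–280. [folklore]
-/

noncomputable section

open Complex MvPolynomial Set

namespace Literature.NumberTheory.Transcendental

/-! ### Total degree of a bound bihomogeneous polynomial -/

/-- A polynomial of bidegree `(a, b)` in `(X, Y)` is weighted-homogeneous of degree `d a + b` for
the weights `(d, 1)`. [folklore] -/
theorem isWeightedHomogeneous_of_bidegree {ι : Type*} {P : MvPolynomial (ι ⊕ ι) ℂ} {a b : ℕ}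
    (hX : IsWeightedHomogeneous (wX ι) P a) (hY : IsWeightedHomogeneous (wY ι) P b)
    (d : ℕ) : IsWeightedHomogeneous (Sum.elim (fun _ => d) fun _ => (1 : ℕ)) P (d * a + b) := by
  classical
  intro m hm
  have ha := hX hm
  have hb := hY hm
  rw [Finsupp.weight_apply, Finsupp.sum] at ha hb ⊢
  have hsplit : ∀ j ∈ m.support, m j • (Sum.elim (fun _ => d) (fun _ => (1 : ℕ)) j) =
      d * (m j • wX ι j) + m j • wY ι j := by
    rintro (j | j) -
    · simp [wX, wY, mul_comm]
    · simp [wX, wY]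
  rw [Finset.sum_congr rfl hsplit, Finset.sum_add_distrib, ← Finset.mul_sum, ha, hb]

/-- **Binding a bihomogeneous `P(X, Y)` of bidegree `(a, b)` with forms `F_j` of degree `d` in `X`
and the variables in `Y` gives a form of degree `d a + b`.** [folklore] -/
theorem isHomogeneous_bind₁_sumElim {ι : Type*} {P : MvPolynomial (ι ⊕ ι) ℂ} {a b : ℕ}
    (hX : IsWeightedHomogeneous (wX ι) P a) (hY : IsWeightedHomogeneous (wY ι) P b)
    {d : ℕ} {F : ι → MvPolynomial ι ℂ} (hF : ∀ j, (F j).IsHomogeneous d) :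
    (bind₁ (Sum.elim F X) P).IsHomogeneous (d * a + b) := by
  have h := (isWeightedHomogeneous_of_bidegree hX hY d).bind₁_of_weights 1
    (h := Sum.elim F X) (w₂ := (1 : ι → ℕ)) (by
      rintro (j | j)
      · have h := hF j
        unfold MvPolynomial.IsHomogeneous at h
        simpa using h
      · have h := isHomogeneous_X ℂ j
        unfold MvPolynomial.IsHomogeneous at h
        simpa using h)
  simpa [IsHomogeneous] using h

namespace GaGmE

namespace Std

variable {β γ δ : Type} [Fintype β] [Fintype γ] [Fintype δ] [DecidableEq γ]
variable (L : PeriodPair) (κM : δ → γ → Kbar)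

/-! ### The multiplication forms -/

/-- **The multiplication forms**: `mulForm [] I = X_I`,
`mulForm (s :: l) I = A^{(s)}_I(mulForm l, X)`. [folklore] -/
def mulForm : List (β ⊕ (γ ⊕ δ) → ℂ) → Option β × ThetaIdx γ δ →
    MvPolynomial (Option β × ThetaIdx γ δ) ℂ
  | [], I => X I
  | s :: l, I => bind₁ (Sum.elim (mulForm l) X) (claw L κM s I)

/-- **The units of the multiplication forms**: `mulUnit [] = 1`,
`mulUnit (s :: l) w = (mulUnit l w)⁴ · U_s((|l|+1) w, w)`. [folklore] -/
def mulUnit : List (β ⊕ (γ ⊕ δ) → ℂ) → (β ⊕ (γ ⊕ δ) → ℂ) → ℂ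
  | [], _ => 1
  | s :: l, w => mulUnit l w ^ 4 * clawUnit (β := β) (δ := δ) L s ((l.length + 1) • w) w

/-- The degrees: `mulDeg 0 = 1`, `mulDeg (n+1) = 4 mulDeg n + 4`. [folklore] -/
def mulDeg : ℕ → ℕ
  | 0 => 1
  | n + 1 => mulDeg n * 4 + 4

omit [Fintype β] [Fintype δ] in
/-- Unfolding, empty chain. [folklore] -/
@[simp] theorem mulForm_nil (I : Option β × ThetaIdx γ δ) : mulForm L κM [] I = X I := rfl

omit [Fintype β] [Fintype δ] in
/-- Unfolding, one more step. [folklore] -/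
@[simp] theorem mulForm_cons (s : β ⊕ (γ ⊕ δ) → ℂ) (l : List (β ⊕ (γ ⊕ δ) → ℂ)) (I : Option β × ThetaIdx γ δ) :
    mulForm L κM (s :: l) I = bind₁ (Sum.elim (mulForm L κM l) X) (claw L κM s I) := rfl

omit [Fintype β] [Fintype δ] [DecidableEq γ] in
/-- Unfolding, empty chain. [folklore] -/
@[simp] theorem mulUnit_nil (w : β ⊕ (γ ⊕ δ) → ℂ) : mulUnit (β := β) (δ := δ) L [] w = 1 := rfl

omit [Fintype β] [Fintype δ] [DecidableEq γ] in
/-- Unfolding, one more step. [folklore] -/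
@[simp] theorem mulUnit_cons (s : β ⊕ (γ ⊕ δ) → ℂ) (l : List (β ⊕ (γ ⊕ δ) → ℂ)) (w : β ⊕ (γ ⊕ δ) → ℂ) :
    mulUnit (β := β) (δ := δ) L (s :: l) w =
      mulUnit (β := β) (δ := δ) L l w ^ 4 * clawUnit (β := β) (δ := δ) L s ((l.length + 1) • w) w := rfl

omit [Fintype β] [Fintype δ] in
/-- **The multiplication forms are forms of degree `mulDeg |l|`.** [folklore] -/
theorem mulForm_isHomogeneous (l : List (β ⊕ (γ ⊕ δ) → ℂ)) (I : Option β × ThetaIdx γ δ) :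
    (mulForm L κM l I).IsHomogeneous (mulDeg l.length) := by
  induction l generalizing I with
  | nil => simpa [mulDeg] using isHomogeneous_X ℂ I
  | cons s l ih =>
    rw [mulForm_cons, List.length_cons, mulDeg]
    exact isHomogeneous_bind₁_sumElim (claw_isWeightedHomogeneous L κM s I)
      (claw_isWeightedHomogeneous_wY L κM s I) ih

omit [Fintype β] [Fintype δ] in
/-- **`F_{mulForm l I}(w) = mulUnit l w · Θ_I((|l| + 1) w)`** for ALL `w`: the forms compute the
multiplication by `|l| + 1` up to the unit. [folklore] -/
theorem thetaEval_mulForm (l : List (β ⊕ (γ ⊕ δ) → ℂ)) (I : Option β × ThetaIdx γ δ) (w : β ⊕ (γ ⊕ δ) → ℂ) :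
    thetaEval L κM (mulForm L κM l I) w = mulUnit (β := β) (δ := δ) L l w * theta L κM I ((l.length + 1) • w) := by
  induction l generalizing I with
  | nil => simp [thetaEval]
  | cons s l ih =>
    rw [mulForm_cons, thetaEval, eval_bind₁, mulUnit_cons, List.length_cons]
    have hfun : (fun i => eval (fun J => theta L κM J w) (Sum.elim (mulForm L κM l) X i)) =
        fun i => mulUnit (β := β) (δ := δ) L l w ^ wX (Option β × ThetaIdx γ δ) i *
          Sum.elim (fun J => theta L κM J ((l.length + 1) • w)) (fun J => theta L κM J w) i := by
      funext i
      rcases i with J | J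
      · simp only [Sum.elim_inl, wX, pow_one]
        exact ih J
      · simp only [Sum.elim_inr, wX, pow_zero, one_mul, eval_X]
    rw [hfun, eval_pow_weight_mul_of_isWeightedHomogeneous (claw_isWeightedHomogeneous L κM s I), eval_claw,
      succ_nsmul]
    ring

omit [Fintype β] [Fintype δ] [DecidableEq γ] in
/-- **Completeness**: for every `n` and every `w` some chain of length `n` from the finite family
`clawFamily` has non-zero unit at `w`. [folklore] -/
theorem exists_mulUnit_ne_zero (n : ℕ) (w : β ⊕ (γ ⊕ δ) → ℂ) :
    ∃ c : Fin n → Fin (nClaw γ),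
      mulUnit (β := β) (δ := δ) L (List.ofFn fun i => clawFamily (β := β) (δ := δ) L (c i)) w ≠ 0 := by
  induction n with
  | zero => exact ⟨Fin.elim0, by simp⟩
  | succ n ih =>
    obtain ⟨c, hc⟩ := ih
    obtain ⟨i, hi⟩ := exists_clawUnit_clawFamily_ne_zero (β := β) (δ := δ) L ((n + 1) • w) w
    refine ⟨Fin.cons i c, ?_⟩
    rw [List.ofFn_succ, mulUnit_cons]
    simp only [Fin.cons_zero, Fin.cons_succ, List.length_ofFn]
    exact mul_ne_zero (pow_ne_zero _ hc) hi

omit [DecidableEq γ] in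
/-- The units are entire. [folklore] -/
theorem analyticOnNhd_mulUnit (l : List (β ⊕ (γ ⊕ δ) → ℂ)) :
    AnalyticOnNhd ℂ (mulUnit (β := β) (δ := δ) L l) univ := by
  induction l with
  | nil => simpa [mulUnit] using (analyticOnNhd_const (v := (1 : ℂ)))
  | cons s l ih =>
    intro w _
    have h1 : AnalyticAt ℂ (mulUnit (β := β) (δ := δ) L l) w := ih w (mem_univ _)
    have hlin : AnalyticAt ℂ (fun v : β ⊕ (γ ⊕ δ) → ℂ => (((l.length + 1) • v, v) :
        (β ⊕ (γ ⊕ δ) → ℂ) × (β ⊕ (γ ⊕ δ) → ℂ))) w := by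
      have hs : AnalyticAt ℂ (fun v : β ⊕ (γ ⊕ δ) → ℂ => (l.length + 1) • v) w := by
        have heq : (fun v : β ⊕ (γ ⊕ δ) → ℂ => (l.length + 1) • v) =
            fun v => ((l.length + 1 : ℕ) : ℂ) • v := by
          funext v
          exact (Nat.cast_smul_eq_nsmul ℂ (l.length + 1) v).symm
        rw [heq]
        exact (analyticAt_const : AnalyticAt ℂ (fun _ : β ⊕ (γ ⊕ δ) → ℂ => ((l.length + 1 : ℕ) : ℂ)) w).smul
          (analyticAt_id : AnalyticAt ℂ (fun v : β ⊕ (γ ⊕ δ) → ℂ => v) w)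
      exact hs.prod analyticAt_id
    have h2 : AnalyticAt ℂ (Function.uncurry (clawUnit (β := β) (δ := δ) L s) ∘
        fun v : β ⊕ (γ ⊕ δ) → ℂ => (((l.length + 1) • v, v) : (β ⊕ (γ ⊕ δ) → ℂ) × (β ⊕ (γ ⊕ δ) → ℂ))) w :=
      (analyticOnNhd_clawUnit L s _ (mem_univ _)).comp hlin
    have h3 := (h1.pow 4).mul h2
    exact h3.congr (Filter.Eventually.of_forall fun v => rfl)

/-- **The complete family of multiplication forms** in one statement: for every `n ≥ 1` there are
finitely many families of forms `Φ^c_I` of one degree `d` and entire units `u_c` without common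
zero with `F_{Φ^c_I}(w) = u_c(w) Θ_I(n w)` for all `w`. [folklore] -/
theorem exists_complete_multiplication_forms (n : ℕ) (hn : 1 ≤ n) :
    ∃ (m d : ℕ) (Φ : Fin m → Option β × ThetaIdx γ δ → MvPolynomial (Option β × ThetaIdx γ δ) ℂ)
      (u : Fin m → (β ⊕ (γ ⊕ δ) → ℂ) → ℂ),
      (∀ k I, (Φ k I).IsHomogeneous d) ∧ (∀ k, AnalyticOnNhd ℂ (u k) univ) ∧
      (∀ k I w, thetaEval L κM (Φ k I) w = u k w * theta L κM I (n • w)) ∧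
      ∀ w, ∃ k, u k w ≠ 0 := by
  classical
  obtain ⟨n, rfl⟩ : ∃ n', n = n' + 1 := ⟨n - 1, by omega⟩
  let e := Fintype.equivFin (Fin n → Fin (nClaw γ))
  let chain : Fin (Fintype.card (Fin n → Fin (nClaw γ))) → List (β ⊕ (γ ⊕ δ) → ℂ) :=
    fun k => List.ofFn fun i => clawFamily (β := β) (δ := δ) L (e.symm k i)
  have hlen : ∀ k, (chain k).length = n := fun k => by simp [chain]
  refine ⟨_, mulDeg n, fun k => mulForm L κM (chain k), fun k => mulUnit (β := β) (δ := δ) L (chain k),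
    fun k I => ?_, fun k => analyticOnNhd_mulUnit L (chain k), fun k I w => ?_, fun w => ?_⟩
  · simpa [hlen] using mulForm_isHomogeneous L κM (chain k) I
  · rw [thetaEval_mulForm, hlen]
  · obtain ⟨c, hc⟩ := exists_mulUnit_ne_zero (β := β) (δ := δ) L n w
    exact ⟨e c, by simpa [chain] using hc⟩

end Std

end GaGmE

end Literature.NumberTheory.Transcendental

end
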